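import Literature.MathematicalPhysics.QuantumLattice.SourcedTorusRegionEnergyBound
import Literature.MathematicalPhysics.QuantumLattice.DWaveSourceNNNHopping
import Literature.MathematicalPhysics.QuantumLattice.TorusDiagOutwardNeighbours
import HarnessLib

/-!
# The pair-sourced `t–t'` Hubbard torus as a translation-invariant region Hamiltonian: region energies of
# `dWaveSourceTorusTT'` are extensive up to a boundary term

Topic `MathematicalPhysics/QuantumLattice` (sequel of `SourcedTorusRegionEnergyBound.lean`; written for the cell
`hubbard-cq`, negation lens N-W0-LOCAL / census (13)). The cell's sourced object of record,
`A_L = dWaveSourceTorusTT' L tp U μ h = H^{tt'}_L(1, tp, U) − μN − h(Δ_d + Δ_d†)` (`DWaveSourceNNNHopping`; Xu et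
al. 2024 eq. (1) with the Koma–Tasaki source), IS a translation-invariant pair-sourced Hubbard Hamiltonian with
STEP couplings in the sense of `SourcedTorusRegionEnergyBound`:

* `ttStepFun L tp` — hopping `1` on the nearest-neighbour steps and `tp` on the diagonal steps of `(ℤ/Lℤ)²`
  (`κ δ = 1[0 ∼ δ] + tp·1[0 ∼_diag δ]`; adjacency of both torus graphs is translation invariant,
  `torusGraph_adj_iff_sub`, `torusDiagGraph_adj_iff_sub`);
* `pairStepFun L g` — pair weight `Σ_{e ∈ {0,±e₁,±e₂}, e ≡ δ} g(e)/√2` on the step `δ` (`pairField_eq_sum_stepWeight`: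
  `Δ_g = Σ_{(x,y)} ω(y − x) b_{xy}` for every form factor `g`);
* **`dWaveSourceTorusTT'_eq_tiSourcedOn`**: `A_L = tiSourcedOn L (ttStepFun L tp) (pairStepFun L ĝ_d) U μ h univ`.

Hence the region Hamiltonians `A_{L,A}` (all terms of `A_L` inside `A ⊆ Λ`: `dWaveSourceTorusTT'On`) obey the two
bounds of `SourcedTorusRegionEnergyBound` for EVERY region `A` (`groundEnergy_dWaveSourceTorusTT'On_le / _ge`):
`(|A|/L²)·E₀(A_L) − C·|∂_R(Λ∖A)| ≤ E₀(A_{L,A}) ≤ (|A|/L²)·E₀(A_L) + C·|∂_R A|`, `C = boundaryConst` — the lattice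
lemma of the site-local ε-lift barrier (`SourcedResponseEpsilonLiftLocal`) for the cell's own model.

References: H. Xu et al., Science 384 (2024) eadh7691, eq. (1) (the `t–t'` Hubbard model) [cite: XuEtAl2024, eq. (1)];
T. Koma, H. Tasaki, J. Stat. Phys. 76 (1994) 745, §1 (the pair source) [cite: KomaTasaki1994, §1]; D. Ruelle,
*Statistical Mechanics: Rigorous Results* (1969), §2.2–2.3, §3.3 [cite: Ruelle1969, §3.3]. All statements [folklore].

Tree: `dWaveSourceTorusTT'`, `hubbardTorusTT'`, `torusDiagGraph` (`DWaveSourceNNNHopping`, `HubbardNNNHopping`),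
`torusGraph` = Mathlib circulant graph (`LatticeGraph`), `localPair_eq_sum_bondPair` (`HohenbergMerminWagnerPairing`),
`hamiltonian_add_hamiltonian_sub_eq_sourcedOn_univ` (`SourcedHubbardRegionCut`), `tiSourcedOn`,
`groundEnergy_tiSourcedOn_le/_ge` (`SourcedTorusRegionEnergyBound`) — REUSED.
-/

noncomputable section

open Matrix Finset Literature.Barriers.HubbardSuperconductivity Literature.Probability.LatticeModels
open scoped ComplexOrder

namespace Literature.MathematicalPhysics.QuantumLattice

open FermionTorus

/-- The `DecidableEq (FermionTorus 2 L)` instance of `SourcedTorusRegionEnergyBound.lean` (= `LinearOrder.toDecidableEq`),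
re-selected so that complements `Λ∖A` written here match that file's lemmas. [folklore] -/
local instance (priority := high) instDecidableEqFermionTorusDWaveRegion {L : ℕ} : DecidableEq (FermionTorus 2 L) :=
  LinearOrder.toDecidableEq

section Steps

variable (L : ℕ)

/-- **The `t–t'` step couplings**: `κ δ = 1` if `δ` is a nearest-neighbour step of `(ℤ/Lℤ)²`, `tp` if it is a
diagonal step, `0` otherwise (as a translation-invariant hopping function). [cite: XuEtAl2024, eq. (1)] -/
def ttStepFun (tp : ℝ) : TorusSite 2 L → ℂ :=
  fun δ => (if (torusGraph 2 L).Adj 0 δ then (1 : ℂ) else 0) + (if (torusDiagGraph L).Adj 0 δ then (tp : ℂ) else 0)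

/-- **The pair step weights** of a form factor `g`: `ω δ = Σ_{e ∈ {0, ±e₁, ±e₂}, e ≡ δ (mod L)} g(e)/√2`.
[cite: KomaTasaki1994, §1] -/
def pairStepFun (g : Site 2 → ℝ) : TorusSite 2 L → ℂ :=
  fun δ => ∑ e ∈ insert (0 : Site 2) unitSteps, if Torus.proj L e = δ then ((g e / Real.sqrt 2 : ℝ) : ℂ) else 0

/-- **Nearest-neighbour adjacency on the torus is translation invariant**: `x ∼ y ↔ 0 ∼ y − x`.
[cite: Ruelle1969, §2.2] -/
theorem torusGraph_adj_iff_sub (x y : TorusSite 2 L) : (torusGraph 2 L).Adj x y ↔ (torusGraph 2 L).Adj 0 (y - x) := by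
  have h := SimpleGraph.circulantGraph_adj_translate (s := Set.range fun i : Fin 2 => (Pi.single i 1 : TorusSite 2 L))
    (u := x) (v := y) (d := -x)
  rw [add_neg_cancel, ← sub_eq_add_neg] at h
  exact h.symm

/-- Relation of the diagonal graph: `x = y + J ↔ 0 = (y − x) + J`. [folklore] -/
private theorem eq_add_iff_zero_eq_sub_add {G : Type*} [AddCommGroup G] (x y J : G) : x = y + J ↔ (0 : G) = y - x + J := by
  constructor
  · intro h; rw [h]; abel
  · intro h
    calc x = x + (y - x + J) := by rw [← h, add_zero]
      _ = y + J := by abel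

/-- **Diagonal adjacency on the torus is translation invariant**: `x ∼ y ↔ 0 ∼ y − x`. [cite: Ruelle1969, §2.2] -/
theorem torusDiagGraph_adj_iff_sub (x y : TorusSite 2 L) :
    (torusDiagGraph L).Adj x y ↔ (torusDiagGraph L).Adj 0 (y - x) := by
  simp only [torusDiagGraph, SimpleGraph.fromRel_adj, ne_eq]
  refine and_congr ?_ (or_congr (exists_congr fun s => ?_) (exists_congr fun s => ?_))
  · exact not_congr (by rw [eq_comm (a := (0 : TorusSite 2 L)), sub_eq_zero, eq_comm])
  · rw [zero_add, sub_eq_iff_eq_add']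
  · exact eq_add_iff_zero_eq_sub_add x y _

/-- Adjacency is symmetric under `δ ↦ −δ` (nearest neighbours). [cite: Ruelle1969, §2.2] -/
theorem torusGraph_adj_zero_neg (δ : TorusSite 2 L) : (torusGraph 2 L).Adj 0 (-δ) ↔ (torusGraph 2 L).Adj 0 δ := by
  rw [show (-δ : TorusSite 2 L) = 0 - δ from (zero_sub δ).symm, ← torusGraph_adj_iff_sub]
  exact (torusGraph 2 L).adj_comm _ _

/-- Adjacency is symmetric under `δ ↦ −δ` (diagonal neighbours). [cite: Ruelle1969, §2.2] -/
theorem torusDiagGraph_adj_zero_neg (δ : TorusSite 2 L) : (torusDiagGraph L).Adj 0 (-δ) ↔ (torusDiagGraph L).Adj 0 δ := by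
  rw [show (-δ : TorusSite 2 L) = 0 - δ from (zero_sub δ).symm, ← torusDiagGraph_adj_iff_sub]
  exact (torusDiagGraph L).adj_comm _ _

/-- **The `t–t'` step couplings are bond-reversal symmetric**: `conj κ(δ) = κ(−δ)`. [cite: Ruelle1969, §2.2] -/
theorem ttStepFun_symm (tp : ℝ) (δ : TorusSite 2 L) : star (ttStepFun L tp δ) = ttStepFun L tp (-δ) := by
  simp only [ttStepFun, torusGraph_adj_zero_neg, torusDiagGraph_adj_zero_neg, star_add, apply_ite star, star_one,
    star_zero, Complex.star_def, Complex.conj_ofReal]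

variable [NeZero L]

omit [NeZero L] in
/-- **The `t–t'` Hubbard couplings are step couplings**:
`hubbardCoupling (n.n. graph) 1 + hubbardCoupling (diagonal graph) tp = stepCoupling L (ttStepFun L tp)`.
[cite: XuEtAl2024, eq. (1)] -/
theorem hubbardCoupling_tt_eq_stepCoupling (tp : ℝ) :
    hubbardCoupling (fermionTorusGraph 2 L) (1 : ℂ) + hubbardCoupling (fermionTorusDiagGraph L) (tp : ℂ) =
      stepCoupling L (ttStepFun L tp) := by
  funext b
  obtain ⟨x, y, σ⟩ := b
  simp only [Pi.add_apply, hubbardCoupling_apply, stepCoupling, ttStepFun, fermionTorusGraph_adj,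
    torusGraph_adj_iff_sub L (toTorusSite x)]
  congr 1
  have h : (fermionTorusDiagGraph L).Adj x y ↔ (torusDiagGraph L).Adj 0 (toTorusSite y - toTorusSite x) := by
    rw [← torusDiagGraph_adj_iff_sub]; exact Iff.rfl
  simp only [h]

/-- **The pair field is a translation-invariant pair sum**: `Δ_g = Σ_{(x,y)} ω(y − x) b_{xy}` with `ω = pairStepFun L g`,
for every form factor `g`. [cite: KomaTasaki1994, §1] -/
theorem pairField_eq_sum_stepWeight (g : Site 2 → ℝ) :
    pairField g L = ∑ z : FermionTorus 2 L × FermionTorus 2 L, stepWeight L (pairStepFun L g) z • bondPair z.1 z.2 := by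
  -- right-hand side: expand `ω` and sum out `y`
  have hR : (∑ z : FermionTorus 2 L × FermionTorus 2 L, stepWeight L (pairStepFun L g) z • bondPair z.1 z.2) =
      ∑ x : FermionTorus 2 L, ∑ e ∈ insert (0 : Site 2) unitSteps, ((g e / Real.sqrt 2 : ℝ) : ℂ) •
        bondPair x (ofTorusSite (toTorusSite x + Torus.proj L e)) := by
    rw [Fintype.sum_prod_type]
    refine Finset.sum_congr rfl fun x _ => ?_
    have h1 : (∑ y : FermionTorus 2 L, stepWeight L (pairStepFun L g) (x, y) • bondPair x y) =
        ∑ y : FermionTorus 2 L, ∑ e ∈ insert (0 : Site 2) unitSteps,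
          (if ofTorusSite (toTorusSite x + Torus.proj L e) = y then ((g e / Real.sqrt 2 : ℝ) : ℂ) • bondPair x y else 0) := by
      refine Finset.sum_congr rfl fun y _ => ?_
      rw [stepWeight, pairStepFun, Finset.sum_smul]
      refine Finset.sum_congr rfl fun e _ => ?_
      have hcond : (Torus.proj L e = toTorusSite y - toTorusSite x) ↔ (ofTorusSite (toTorusSite x + Torus.proj L e) = y) := by
        constructor
        · intro h
          rw [h, add_sub_cancel, ofTorusSite_toTorusSite]
        · intro h
          rw [← h, toTorusSite_ofTorusSite, add_sub_cancel_left]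
      by_cases hc : Torus.proj L e = toTorusSite y - toTorusSite x
      · rw [if_pos hc, if_pos (hcond.1 hc)]
      · rw [if_neg hc, if_neg (fun h => hc (hcond.2 h)), zero_smul]
    rw [h1, Finset.sum_comm]
    refine Finset.sum_congr rfl fun e _ => ?_
    rw [Finset.sum_ite_eq, if_pos (Finset.mem_univ _)]
  -- left-hand side: `Σ_x P_x` with `P_x = Σ_e (g e/√2) b_{x, x+e}`, reindexed along `equivTorusSite`
  rw [hR, pairField]
  refine Fintype.sum_equiv (equivTorusSite (d := 2) (L := L)).symm (fun x : TorusSite 2 L => localPair g L x)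
    (fun x' : FermionTorus 2 L => ∑ e ∈ insert (0 : Site 2) unitSteps, ((g e / Real.sqrt 2 : ℝ) : ℂ) •
      bondPair x' (ofTorusSite (toTorusSite x' + Torus.proj L e))) fun x => ?_
  rw [localPair_eq_sum_bondPair]
  simp [equivTorusSite]

end Steps

/-! ### The sourced `t–t'` torus as a translation-invariant region Hamiltonian -/

section Model

variable (L : ℕ) [NeZero L]

/-- **The region Hamiltonians of the pair-sourced `t–t'` torus**: all terms of
`dWaveSourceTorusTT' L tp U μ h` (on-site `U, μ`; hoppings `1, tp`; `d`-wave pairs `h`) with both ends in `A`.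
[cite: KomaTasaki1994, §1] -/
def dWaveSourceTorusTT'On (tp U μ h : ℝ) (A : Finset (FermionTorus 2 L)) :
    Matrix (Finset (Orb (FermionTorus 2 L))) (Finset (Orb (FermionTorus 2 L))) ℂ :=
  tiSourcedOn L (ttStepFun L tp) (pairStepFun L dWaveFormFactor) U μ h A

/-- **`A_L = tiSourcedOn L (ttStepFun L tp) (pairStepFun L ĝ_d) U μ h univ`**: the cell's sourced `t–t'` torus is a
translation-invariant step-coupling Hamiltonian, and its restriction to the whole volume is itself.
[cite: XuEtAl2024, eq. (1)] -/
theorem dWaveSourceTorusTT'_eq_tiSourcedOn (tp U μ h : ℝ) :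
    dWaveSourceTorusTT' L tp U μ h = dWaveSourceTorusTT'On L tp U μ h Finset.univ := by
  rw [dWaveSourceTorusTT'On, tiSourcedOn, dWaveSourceTorusTT', hubbardTorusTT', pairField_eq_sum_stepWeight,
    ← hubbardCoupling_tt_eq_stepCoupling, ← Complex.ofReal_one]
  exact hamiltonian_add_hamiltonian_sub_eq_sourcedOn_univ _ U μ h _ _ 1 tp

omit [NeZero L] in
/-- The region Hamiltonians of the sourced `t–t'` torus are Hermitian. [cite: KomaTasaki1994, §1] -/
theorem isHermitian_dWaveSourceTorusTT'On (tp U μ h : ℝ) (A : Finset (FermionTorus 2 L)) :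
    (dWaveSourceTorusTT'On L tp U μ h A).IsHermitian :=
  isHermitian_tiSourcedOn (ttStepFun_symm L tp) _ U μ h A

/-- **Upper bound for the cell's model**: for every region `B` of the torus,
`E₀(A_{L,B}) ≤ (|B|/N)·E₀(A_L) + |∂_R B|·C` (`N = |Λ|`, `C = boundaryConst`). [cite: Ruelle1969, §2.3] -/
theorem groundEnergy_dWaveSourceTorusTT'On_le (tp U μ h : ℝ) (B : Finset (FermionTorus 2 L)) :
    (dWaveSourceTorusTT'On L tp U μ h B).groundEnergy ≤
      (B.card : ℝ) / Fintype.card (FermionTorus 2 L) * (dWaveSourceTorusTT' L tp U μ h).groundEnergy +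
        (torusBoundary L (ttStepFun L tp) (pairStepFun L dWaveFormFactor) B).card *
          boundaryConst L (ttStepFun L tp) (pairStepFun L dWaveFormFactor) h := by
  rw [dWaveSourceTorusTT'_eq_tiSourcedOn]
  exact groundEnergy_tiSourcedOn_le (ttStepFun_symm L tp) _ U μ h B

/-- **Lower bound for the cell's model (the lattice lemma of the site-local ε-lift, census (13))**: for EVERY
region `A` of the torus, `(|A|/N)·E₀(A_L) − |∂_R(Λ∖A)|·C ≤ E₀(A_{L,A})` — the terms of
`dWaveSourceTorusTT' L tp U μ h` inside an arbitrary region carry at least their volume share of the torus ground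
energy minus a boundary term; no gap, no uniqueness, no shape condition. [cite: Ruelle1969, §3.3] -/
theorem groundEnergy_dWaveSourceTorusTT'On_ge (tp U μ h : ℝ) (A : Finset (FermionTorus 2 L)) :
    (A.card : ℝ) / Fintype.card (FermionTorus 2 L) * (dWaveSourceTorusTT' L tp U μ h).groundEnergy -
        (torusBoundary L (ttStepFun L tp) (pairStepFun L dWaveFormFactor) Aᶜ).card *
          boundaryConst L (ttStepFun L tp) (pairStepFun L dWaveFormFactor) h ≤
      (dWaveSourceTorusTT'On L tp U μ h A).groundEnergy := by
  rw [dWaveSourceTorusTT'_eq_tiSourcedOn]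
  exact groundEnergy_tiSourcedOn_ge (ttStepFun_symm L tp) _ U μ h A

/-- Ruelle's cut for the cell's model over an arbitrary region: `E₀(A_L) ≤ E₀(A_{L,A}) + E₀(A_{L,Λ∖A})`.
[cite: Ruelle1969, §2.2] -/
theorem groundEnergy_dWaveSourceTorusTT'_le_add (tp U μ h : ℝ) (A : Finset (FermionTorus 2 L)) :
    (dWaveSourceTorusTT' L tp U μ h).groundEnergy ≤
      (dWaveSourceTorusTT'On L tp U μ h A).groundEnergy + (dWaveSourceTorusTT'On L tp U μ h Aᶜ).groundEnergy := by
  rw [dWaveSourceTorusTT'_eq_tiSourcedOn]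
  exact groundEnergy_sourcedOn_univ_le_add (stepCoupling_symm (ttStepFun_symm L tp)) _ U μ h A

end Model

/-! ### The boundary constant of the `t–t'` `d`-wave source made numeric: `C ≤ 8 + 8|t'| + 8√2|h|` -/

section Constant

variable (L : ℕ) [NeZero L]

/-- **The hopping part of the boundary constant**: `Σ_δ ‖κ_{tt'}(δ)‖ ≤ 4 + 4|t'|` (at most four nearest-neighbour
and four diagonal steps leave a site: the tree's `card_filter_torusGraph_adj_le`, `card_filter_torusDiagGraph_adj_le`).
[cite: Ruelle1969, §2.3] -/
theorem sum_norm_ttStepFun_le (tp : ℝ) : ∑ δ : TorusSite 2 L, ‖ttStepFun L tp δ‖ ≤ 4 + 4 * |tp| := by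
  classical
  have h1 : ∀ δ : TorusSite 2 L, ‖ttStepFun L tp δ‖ ≤
      (if (torusGraph 2 L).Adj 0 δ then (1 : ℝ) else 0) + |tp| * (if (torusDiagGraph L).Adj 0 δ then (1 : ℝ) else 0) := by
    intro δ
    unfold ttStepFun
    refine (norm_add_le _ _).trans (add_le_add ?_ ?_)
    · split_ifs <;> simp
    · split_ifs <;> simp [Complex.norm_real, Real.norm_eq_abs]
  refine (Finset.sum_le_sum fun δ _ => h1 δ).trans ?_
  rw [Finset.sum_add_distrib, ← Finset.mul_sum, Finset.sum_boole, Finset.sum_boole]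
  have hA : (Finset.univ.filter fun δ : TorusSite 2 L => (torusGraph 2 L).Adj 0 δ).card ≤ 4 := by
    simpa using card_filter_torusGraph_adj_le L (0 : TorusSite 2 L)
  have hD : (Finset.univ.filter fun δ : TorusSite 2 L => (torusDiagGraph L).Adj 0 δ).card ≤ 4 :=
    card_filter_torusDiagGraph_adj_le (0 : TorusSite 2 L)
  have hA' : ((Finset.univ.filter fun δ : TorusSite 2 L => (torusGraph 2 L).Adj 0 δ).card : ℝ) ≤ 4 := by exact_mod_cast hA
  have hD' : ((Finset.univ.filter fun δ : TorusSite 2 L => (torusDiagGraph L).Adj 0 δ).card : ℝ) ≤ 4 := by exact_mod_cast hD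
  nlinarith [abs_nonneg tp]

/-- `|ĝ_d(e)| = 1` on the four unit steps. [cite: Scalapino1995, §2 eq. (2.3)] -/
theorem abs_dWaveFormFactor_of_mem_unitSteps {e : Site 2} (he : e ∈ unitSteps) : |dWaveFormFactor e| = 1 := by
  simp only [unitSteps, Finset.mem_insert, Finset.mem_singleton] at he
  rcases he with rfl | rfl | rfl | rfl
  · rw [dWaveFormFactor, if_pos (Or.inl rfl)]; norm_num
  · rw [dWaveFormFactor, if_pos (Or.inr rfl)]; norm_num
  · rw [dWaveFormFactor, if_neg (by decide), if_pos (Or.inl rfl)]; norm_num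
  · rw [dWaveFormFactor, if_neg (by decide), if_pos (Or.inr rfl)]; norm_num

/-- `Σ_{e ∈ {0} ∪ unitSteps} |ĝ_d(e)| = 4`. [cite: Scalapino1995, §2 eq. (2.3)] -/
theorem sum_abs_dWaveFormFactor : ∑ e ∈ insert (0 : Site 2) unitSteps, |dWaveFormFactor e| = 4 := by
  have hcard : (unitSteps).card = 4 := by decide
  rw [Finset.sum_insert (by decide : (0 : Site 2) ∉ unitSteps), dWaveFormFactor_zero, abs_zero, zero_add,
    Finset.sum_congr rfl fun e he => abs_dWaveFormFactor_of_mem_unitSteps he, Finset.sum_const, hcard]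
  norm_num

/-- **The pair part of the boundary constant**: `Σ_δ ‖ω_d(δ)‖ ≤ 2√2` (`Σ_e |ĝ_d(e)|/√2 = 4/√2`).
[cite: KomaTasaki1994, §1] -/
theorem sum_norm_pairStepFun_dWave_le : ∑ δ : TorusSite 2 L, ‖pairStepFun L dWaveFormFactor δ‖ ≤ 2 * Real.sqrt 2 := by
  classical
  have h1 : ∀ δ : TorusSite 2 L, ‖pairStepFun L dWaveFormFactor δ‖ ≤
      ∑ e ∈ insert (0 : Site 2) unitSteps, (if Torus.proj L e = δ then |dWaveFormFactor e| / Real.sqrt 2 else 0) := by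
    intro δ
    unfold pairStepFun
    refine (norm_sum_le _ _).trans (Finset.sum_le_sum fun e _ => ?_)
    split_ifs
    · rw [Complex.norm_real, Real.norm_eq_abs, abs_div, abs_of_nonneg (Real.sqrt_nonneg 2)]
    · simp
  refine (Finset.sum_le_sum fun δ _ => h1 δ).trans ?_
  rw [Finset.sum_comm]
  simp only [Finset.sum_ite_eq, Finset.mem_univ, if_true]
  rw [← Finset.sum_div, sum_abs_dWaveFormFactor]
  have hs : (0 : ℝ) < Real.sqrt 2 := Real.sqrt_pos.2 (by norm_num)
  rw [div_le_iff₀ hs]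
  nlinarith [Real.mul_self_sqrt (show (0 : ℝ) ≤ 2 by norm_num)]

/-- **The boundary constant of the sourced `t–t'` `d`-wave torus is at most `8 + 8|t'| + 8√2|h|`**
(`C = Σ_δ (2‖κ δ‖ + 4|h| ‖ω δ‖)`: four nearest-neighbour and four diagonal hoppings through a site, both spins;
four `d`-wave bonds through a site of weight `1/√2` with their adjoints). [cite: Ruelle1969, §2.3] -/
theorem boundaryConst_dWaveTT'_le (tp h : ℝ) :
    boundaryConst L (ttStepFun L tp) (pairStepFun L dWaveFormFactor) h ≤ 8 + 8 * |tp| + 8 * Real.sqrt 2 * |h| := by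
  rw [boundaryConst, Finset.sum_add_distrib, ← Finset.mul_sum, ← Finset.mul_sum]
  have h1 := sum_norm_ttStepFun_le L tp
  have h2 := sum_norm_pairStepFun_dWave_le L
  have h3 : 4 * |h| * ∑ δ : TorusSite 2 L, ‖pairStepFun L dWaveFormFactor δ‖ ≤ 4 * |h| * (2 * Real.sqrt 2) :=
    mul_le_mul_of_nonneg_left h2 (by positivity)
  linarith

/-- **The lattice lemma of census (13) for the cell's model with a NUMERIC constant**: for every region `A` of the
`L × L` torus, `(|A|/L²)·E₀(dWaveSourceTorusTT' L tp U μ h) − (8 + 8|t'| + 8√2|h|)·|∂_R(Λ∖A)| ≤ E₀(A_{L,A})`.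
[cite: Ruelle1969, §3.3] -/
theorem groundEnergy_dWaveSourceTorusTT'On_ge_numeric (tp U μ h : ℝ) (A : Finset (FermionTorus 2 L)) :
    (A.card : ℝ) / Fintype.card (FermionTorus 2 L) * (dWaveSourceTorusTT' L tp U μ h).groundEnergy -
        (torusBoundary L (ttStepFun L tp) (pairStepFun L dWaveFormFactor) Aᶜ).card * (8 + 8 * |tp| + 8 * Real.sqrt 2 * |h|) ≤
      (dWaveSourceTorusTT'On L tp U μ h A).groundEnergy := by
  have h1 := groundEnergy_dWaveSourceTorusTT'On_ge L tp U μ h A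
  have h2 := boundaryConst_dWaveTT'_le L tp h
  have h3 : (0 : ℝ) ≤ (torusBoundary L (ttStepFun L tp) (pairStepFun L dWaveFormFactor) Aᶜ).card := Nat.cast_nonneg _
  nlinarith

end Constant

end Literature.MathematicalPhysics.QuantumLattice
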